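import Literature.NumberTheory.NumberFields.UnitsEvenEigenunitsCount
import Mathlib.Tactic.Module
import HarnessLib

/-!
# Herbrand's Minkowski unit in an even eigenspace: for a CM field `K` Galois over `ℚ`, `p ∤ [K:ℚ]`, and an even character
# `θ ≠ 1` of `Gal(K/ℚ)` (`θ ≡ e` mod `p`), there IS a unit `u` with `σ(u) = u^{e σ} · v_σ^p` for all `σ` and `u ∉ μ_K · E_K^p`

Topic `NumberTheory/NumberFields`; namespace `Literature.NumberTheory.NumberFields.UnitGalois`. THEOREMS ONLY (no definition,
no named fact, no `sorry`). Third file of the Herbrand series (`UnitsEvenChiComponentRankOne.lean`: `e_θ(ℤ_p ⊗ E_K/μ_K)` has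
`ℤ_p`-rank ONE; `UnitsEvenEigenunitsCount.lean`: at most `p` eigen-units mod `K^{×p}`). Here the EXISTENCE half («one Minkowski
unit per even character `θ ≠ 1`», [Tate1984Stark] Ch. I §4 (4.2, «d'après un théorème de Minkowski il existe une unité ε …»),
[Washington1997] §5.5 / Prop. 8.10-type decompositions of `E/E^p`): a generator `b` of the rank-one lattice `e_θ(ℤ_p ⊗ E/μ)` is not
in `p(ℤ_p ⊗ E/μ)`; approximating its `ℤ_p`-coefficients by integers gives a unit `u₁` with `1 ⊗ [u₁] ≡ b (mod p)`, and the
INTEGRAL PROJECTOR `u = ∏_τ τ(u₁)^{e(τ⁻¹)}` then satisfies the eigen-relations EXACTLY (`σu = u^{e σ} v^p`, `v` a unit — the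
exponents `e(τ⁻¹σ) − e(τ⁻¹)e(σ)` are multiples of `p`) and `1 ⊗ [u] ≡ |G|·b ≢ 0 (mod p)`, so `u ∉ μ_K·E_K^p` (in particular
`u ∉ K^{×p}`). This is the unit radical that Kummer theory turns into a character of `Γ_K` unramified outside `p` in the reflected
(odd) eigenspace — the `+1` of Leopoldt's reflection inequality.

* `exists_one_tmul_add_smul` — every `y ∈ ℤ_p ⊗ V` is `1 ⊗ w + p·z`;
* `exists_int_mul_eq_of_toZMod_eq` — `e(τ⁻¹σ) = e(τ⁻¹)e(σ) + p·k` in `ℤ` when `θ ≡ e`;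
* **`exists_even_eigenunit`** — the statement of the title.
-/

noncomputable section

namespace Literature.NumberTheory.NumberFields

namespace UnitGalois

open Literature.RepresentationTheory.FiniteGroups
open _root_.NumberField _root_.NumberField.Units _root_.NumberField.InfinitePlace _root_.Module
open scoped TensorProduct Classical

set_option maxSynthPendingDepth 3

section Algebra

variable {p : ℕ} [Fact p.Prime]

/-- **Every element of `ℤ_p ⊗ V` is `1 ⊗ w + p · z`** (approximate the `ℤ_p`-coefficients by natural numbers mod `p`).
[folklore] -/
private theorem exists_one_tmul_add_smul {V : Type*} [AddCommGroup V] (y : ℤ_[p] ⊗[ℤ] V) :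
    ∃ (w : V) (z : ℤ_[p] ⊗[ℤ] V), y = (1 : ℤ_[p]) ⊗ₜ[ℤ] w + (p : ℤ_[p]) • z := by
  induction y using TensorProduct.induction_on with
  | zero => exact ⟨0, 0, by rw [TensorProduct.tmul_zero, smul_zero, add_zero]⟩
  | tmul c v =>
    have hmem : c - (c.zmodRepr : ℤ_[p]) ∈ IsLocalRing.maximalIdeal ℤ_[p] := PadicInt.sub_zmodRepr_mem c
    rw [PadicInt.maximalIdeal_eq_span_p, Ideal.mem_span_singleton'] at hmem
    obtain ⟨d, hd⟩ := hmem
    refine ⟨c.zmodRepr • v, d ⊗ₜ[ℤ] v, ?_⟩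
    rw [TensorProduct.tmul_smul, TensorProduct.smul_tmul', TensorProduct.smul_tmul', ← TensorProduct.add_tmul]
    congr 1
    rw [smul_eq_mul, mul_comm, hd, nsmul_eq_mul, mul_one]
    ring
  | add y₁ y₂ h₁ h₂ =>
    obtain ⟨w₁, z₁, h1⟩ := h₁
    obtain ⟨w₂, z₂, h2⟩ := h₂
    exact ⟨w₁ + w₂, z₁ + z₂, by rw [h1, h2, TensorProduct.tmul_add, smul_add]; abel⟩

/-- `‖x − n‖ < 1 ⟹ x ≡ n (mod p)`, read through `PadicInt.toZMod`. [folklore] -/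
private theorem toZMod_eq_of_norm_sub_lt_one {x : ℤ_[p]} {n : ℕ} (h : ‖x - (n : ℤ_[p])‖ < 1) :
    PadicInt.toZMod x = (n : ZMod p) := by
  have hmem : x - (n : ℤ_[p]) ∈ RingHom.ker (PadicInt.toZMod (p := p)) := by
    rw [PadicInt.ker_toZMod]
    exact PadicInt.mem_nonunits.2 h
  rw [RingHom.mem_ker, map_sub, map_natCast, sub_eq_zero] at hmem
  exact hmem

/-- `θ ≡ e (mod p)` ⟹ **`e(a b) = e(a) e(b) + p k` for some integer `k`**. [folklore] -/
private theorem exists_int_mul_eq_of_norm_lt {G : Type*} [Group G] (θ : G →* ℤ_[p]ˣ) (e : G → ℕ)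
    (hθe : ∀ σ : G, ‖((θ σ : ℤ_[p]ˣ) : ℤ_[p]) - (e σ : ℤ_[p])‖ < 1) (a b : G) :
    ∃ k : ℤ, (e (a * b) : ℤ) = (e a : ℤ) * (e b : ℤ) + (p : ℤ) * k := by
  have h1 : PadicInt.toZMod ((θ (a * b) : ℤ_[p]ˣ) : ℤ_[p]) = (e (a * b) : ZMod p) :=
    toZMod_eq_of_norm_sub_lt_one (hθe (a * b))
  have h2 : PadicInt.toZMod ((θ (a * b) : ℤ_[p]ˣ) : ℤ_[p]) = (e a : ZMod p) * (e b : ZMod p) := by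
    rw [map_mul, Units.val_mul, map_mul, toZMod_eq_of_norm_sub_lt_one (hθe a), toZMod_eq_of_norm_sub_lt_one (hθe b)]
  have h3 : ((e (a * b) : ℤ) : ZMod p) = (((e a : ℤ) * (e b : ℤ) : ℤ) : ZMod p) := by
    push_cast
    rw [← h1, h2]
  rw [ZMod.intCast_eq_intCast_iff, Int.modEq_iff_dvd] at h3
  obtain ⟨k, hk⟩ := h3
  exact ⟨-k, by linarith⟩

end Algebra

section Existence

variable {K : Type*} [Field K] [NumberField K] [IsCMField K] [IsGalois ℚ K] {p : ℕ} [Fact p.Prime]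

/-- **HERBRAND'S MINKOWSKI UNIT IN AN EVEN EIGENSPACE.** Let `K` be a CM field, Galois over `ℚ`, `p ∤ [K:ℚ]`,
`θ : Gal(K/ℚ) →* ℤ_pˣ` EVEN (`θ(c) = 1`) and `≠ 1`, and `e : Gal(K/ℚ) → ℕ` with `θ ≡ e (mod p)`. Then there is a unit
`u ∈ 𝓞_K^×` with EXACT eigen-relations **`σ(u) = u^{e σ} · v_σ^p`** (`v_σ` a unit) for every `σ`, which is **not in `μ_K · E_K^p`**
(`u ≠ ζ v^p` for all roots of unity `ζ` and units `v`). Construction: a generator `b` of the rank-one `ℤ_p`-module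
`e_θ(ℤ_p ⊗ E_K/μ_K)` (`finrank_chiComponent_unitsModTorsion_eq_one`) lies outside `p(ℤ_p ⊗ E_K/μ_K)`; write `b = 1 ⊗ [u₁] + p z`
and put `u = ∏_τ τ(u₁)^{e(τ⁻¹)}` (integral projector): `σ u = ∏_ρ ρ(u₁)^{e(ρ⁻¹σ)}` with `e(ρ⁻¹σ) = e(ρ⁻¹)e(σ) + p k_ρ`, and
`1 ⊗ [u] ≡ Σ_τ e(τ⁻¹)θ(τ) b ≡ |G| b ≢ 0 (mod p)`.
[cite: Tate1984Stark, Ch. I §4 (4.2: «d'après un théorème de Minkowski il existe une unité ε …»), §3 Prop. 3.4] [cite: Washington1997, §5.5 and §8.3 (E/E^p as a Galois module)] -/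
theorem exists_even_eigenunit (hpK : ¬ p ∣ finrank ℚ K) (θ : Gal(K/ℚ) →* ℤ_[p]ˣ) (hθ : θ ≠ 1)
    (hc : θ ((IsCMField.complexConj K).restrictScalars ℚ) = 1) (e : Gal(K/ℚ) → ℕ)
    (hθe : ∀ σ : Gal(K/ℚ), ‖((θ σ : ℤ_[p]ˣ) : ℤ_[p]) - (e σ : ℤ_[p])‖ < 1) :
    ∃ u : (𝓞 K)ˣ, (∀ σ : Gal(K/ℚ), ∃ v : (𝓞 K)ˣ, unitsGal σ u = u ^ e σ * v ^ p) ∧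
      ∀ ζ : (𝓞 K)ˣ, ζ ∈ torsion K → ∀ v : (𝓞 K)ˣ, u ≠ ζ * v ^ p := by
  have hp : p.Prime := Fact.out
  have hG : IsUnit (Fintype.card Gal(K/ℚ) : ℤ_[p]) := by
    rw [← Nat.card_eq_fintype_card, IsGalois.card_aut_eq_finrank, PadicInt.isUnit_iff,
      PadicInt.norm_natCast_eq_one_iff]
    exact (Nat.Prime.coprime_iff_not_dvd hp).2 hpK
  obtain ⟨ρ, hρ⟩ := exists_unitsModTorsionRep K
  set N := ℤ_[p] ⊗[ℤ] Additive ((𝓞 K)ˣ ⧸ torsion K)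
  set ρp := baseChangeRep ℤ_[p] ρ with hρp
  set C := chiComponent ρp (fun g => ((θ g : ℤ_[p]ˣ) : ℤ_[p])) with hC
  have hC1 : finrank ℤ_[p] C = 1 := finrank_chiComponent_unitsModTorsion_eq_one hpK hρ θ hθ hc
  -- the class map `a : E → E/μ` (additive) and the action
  let a : (𝓞 K)ˣ → Additive ((𝓞 K)ˣ ⧸ torsion K) := fun y => Additive.ofMul (QuotientGroup.mk y)
  have ha_mul : ∀ y y' : (𝓞 K)ˣ, a (y * y') = a y + a y' := fun y y' => by
    simp only [a, QuotientGroup.mk_mul, ofMul_mul]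
  have ha_pow : ∀ (y : (𝓞 K)ˣ) (n : ℕ), a (y ^ n) = n • a y := fun y n => by
    simp only [a, QuotientGroup.mk_pow, ofMul_pow]
  have ha_prod : ∀ (f : Gal(K/ℚ) → (𝓞 K)ˣ), a (∏ τ, f τ) = ∑ τ, a (f τ) := fun f => by
    simp only [a, QuotientGroup.mk_prod, ofMul_prod]
  have hρa : ∀ (σ : Gal(K/ℚ)) (y : (𝓞 K)ˣ), ρp σ ((1 : ℤ_[p]) ⊗ₜ a y) = (1 : ℤ_[p]) ⊗ₜ a (unitsGal σ y) := by
    intro σ y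
    rw [hρp, baseChangeRep_apply_tmul, hρ]
    rfl
  -- a generator `b` of `C`, an eigenvector not divisible by `p`
  let bs := Module.Free.chooseBasis ℤ_[p] C
  have hcard : Fintype.card (Module.Free.ChooseBasisIndex ℤ_[p] C) = 1 := by
    rw [← Module.finrank_eq_card_chooseBasisIndex, hC1]
  obtain ⟨i₀, hi₀⟩ := Fintype.card_eq_one_iff.1 hcard
  have hrep : ∀ x : C, x = (bs.repr x i₀) • bs i₀ := fun x => by
    conv_lhs => rw [← bs.sum_repr x]
    rw [Fintype.sum_eq_single i₀ (fun j hj => absurd (hi₀ j) hj)]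
  set b : N := (bs i₀ : N) with hbdef
  have hbeig : ∀ g, ρp g b = ((θ g : ℤ_[p]ˣ) : ℤ_[p]) • b :=
    (mem_chiComponent_character_iff ρp θ hG b).1 (bs i₀).2
  have hbp : ∀ z : N, b ≠ (p : ℤ_[p]) • z := by
    intro z hz
    have h1 : charProjector ρp (fun g => ((θ g : ℤ_[p]ˣ) : ℤ_[p])) b = b :=
      charProjector_character_apply_of_forall ρp θ hG hbeig
    set y : C := ⟨charProjector ρp (fun g => ((θ g : ℤ_[p]ˣ) : ℤ_[p])) z,
      charProjector_mem_chiComponent ρp _ z⟩ with hy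
    have h2 : b = (p : ℤ_[p]) • (y : N) := by rw [← h1, hz, map_smul]
    have h3 : (y : N) = (bs.repr y i₀) • b := by
      have h := congrArg (fun x : C => (x : N)) (hrep y)
      rw [Submodule.coe_smul] at h
      exact h
    have h4 : (1 - (p : ℤ_[p]) * bs.repr y i₀) • b = 0 := by
      rw [sub_smul, one_smul, mul_smul, ← h3, ← h2, sub_self]
    have hne : (1 - (p : ℤ_[p]) * bs.repr y i₀) ≠ 0 := by
      apply IsUnit.ne_zero
      apply IsLocalRing.isUnit_one_sub_self_of_mem_nonunits
      rw [PadicInt.mem_nonunits, norm_mul]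
      calc ‖(p : ℤ_[p])‖ * ‖bs.repr y i₀‖ ≤ ‖(p : ℤ_[p])‖ * 1 :=
            mul_le_mul_of_nonneg_left (PadicInt.norm_le_one _) (norm_nonneg _)
        _ < 1 := by
            rw [mul_one, PadicInt.norm_p]
            exact inv_lt_one_of_one_lt₀ (by exact_mod_cast hp.one_lt)
    have hb0 : b = 0 := (smul_eq_zero.mp h4).resolve_left hne
    exact bs.ne_zero i₀ (Subtype.ext hb0)
  -- approximate `b` by a unit: `b = 1 ⊗ [u₁] + p z`
  obtain ⟨w, z, hwz⟩ := exists_one_tmul_add_smul b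
  obtain ⟨u₁, hu₁⟩ := QuotientGroup.mk_surjective (Additive.toMul w)
  have hw : a u₁ = w := by simp only [a, hu₁, ofMul_toMul]
  -- `θ(τ) e(τ⁻¹) = 1 + p d_τ`
  have hd : ∀ t : Gal(K/ℚ), ∃ d : ℤ_[p], ((θ t : ℤ_[p]ˣ) : ℤ_[p]) * (e t⁻¹ : ℤ_[p]) = 1 + (p : ℤ_[p]) * d := by
    intro t
    have hmem : ((θ t⁻¹ : ℤ_[p]ˣ) : ℤ_[p]) - (e t⁻¹ : ℤ_[p]) ∈ IsLocalRing.maximalIdeal ℤ_[p] :=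
      PadicInt.mem_nonunits.2 (hθe t⁻¹)
    rw [PadicInt.maximalIdeal_eq_span_p, Ideal.mem_span_singleton'] at hmem
    obtain ⟨d', hd'⟩ := hmem
    refine ⟨-(((θ t : ℤ_[p]ˣ) : ℤ_[p]) * d'), ?_⟩
    have h1 : ((θ t : ℤ_[p]ˣ) : ℤ_[p]) * ((θ t⁻¹ : ℤ_[p]ˣ) : ℤ_[p]) = 1 := by
      rw [← Units.val_mul, ← map_mul, mul_inv_cancel, map_one, Units.val_one]
    have h2 : (e t⁻¹ : ℤ_[p]) = ((θ t⁻¹ : ℤ_[p]ˣ) : ℤ_[p]) - d' * (p : ℤ_[p]) := by rw [hd']; ring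
    rw [h2, mul_sub, h1]
    ring
  choose d hdd using hd
  -- the Minkowski unit: the integral projector applied to `u₁`
  set f : Gal(K/ℚ) → (𝓞 K)ˣ := fun τ => unitsGal τ u₁ with hf
  refine ⟨∏ τ : Gal(K/ℚ), f τ ^ e τ⁻¹, fun σ => ?_, ?_⟩
  · -- exact eigen-relation
    have hk : ∀ ρ' : Gal(K/ℚ), ∃ k : ℤ, (e (ρ'⁻¹ * σ) : ℤ) = (e ρ'⁻¹ : ℤ) * (e σ : ℤ) + (p : ℤ) * k :=
      fun ρ' => exists_int_mul_eq_of_norm_lt θ e hθe ρ'⁻¹ σ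
    choose k hk using hk
    refine ⟨∏ ρ' : Gal(K/ℚ), f ρ' ^ k ρ', ?_⟩
    have hstep : unitsGal σ (∏ τ : Gal(K/ℚ), f τ ^ e τ⁻¹) = ∏ ρ' : Gal(K/ℚ), f ρ' ^ e (ρ'⁻¹ * σ) := by
      rw [map_prod]
      simp_rw [map_pow]
      have hcomp : ∀ τ : Gal(K/ℚ), unitsGal σ (f τ) = f (σ * τ) := fun τ => by
        rw [hf]; exact (unitsGal_mul σ τ u₁).symm
      simp_rw [hcomp]
      exact Fintype.prod_equiv (Equiv.mulLeft σ) _ _ (fun τ => by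
        simp only [Equiv.coe_mulLeft, mul_inv_rev, inv_mul_cancel_right])
    rw [hstep, ← Finset.prod_pow, ← Finset.prod_pow, ← Finset.prod_mul_distrib]
    refine Finset.prod_congr rfl fun ρ' _ => ?_
    rw [← zpow_natCast, ← zpow_natCast (f ρ' ^ e ρ'⁻¹), ← zpow_natCast (f ρ' ^ k ρ'), ← zpow_natCast (f ρ'),
      ← zpow_mul, ← zpow_mul, ← zpow_add, hk ρ', mul_comm (k ρ') (p : ℤ)]
  · -- `u ∉ μ_K · E^p`: `1 ⊗ [u] ≡ |G| b (mod p)`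
    intro ζ hζ v hv
    have hx : (1 : ℤ_[p]) ⊗ₜ[ℤ] a (∏ τ : Gal(K/ℚ), f τ ^ e τ⁻¹) =
        (Fintype.card Gal(K/ℚ) : ℤ_[p]) • b +
          (p : ℤ_[p]) • ∑ τ : Gal(K/ℚ), (d τ • b - (e τ⁻¹ : ℤ_[p]) • ρp τ z) := by
      rw [ha_prod, TensorProduct.tmul_sum]
      have hterm : ∀ τ : Gal(K/ℚ), (1 : ℤ_[p]) ⊗ₜ[ℤ] a (f τ ^ e τ⁻¹) =
          b + (p : ℤ_[p]) • (d τ • b - (e τ⁻¹ : ℤ_[p]) • ρp τ z) := by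
        intro τ
        rw [ha_pow, TensorProduct.tmul_smul, ← hρa, hw, ← Nat.cast_smul_eq_nsmul ℤ_[p]]
        have h1 : (1 : ℤ_[p]) ⊗ₜ[ℤ] w = b - (p : ℤ_[p]) • z := by rw [hwz, add_sub_cancel_right]
        rw [h1, map_sub, map_smul, hbeig, smul_sub, smul_smul, mul_comm, hdd τ]
        module
      simp_rw [hterm]
      rw [Finset.sum_add_distrib, Finset.sum_const, Finset.card_univ, ← Finset.smul_sum, ← Nat.cast_smul_eq_nsmul ℤ_[p]]
    -- from `u = ζ v^p`: `1 ⊗ [u] = p • (1 ⊗ [v])`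
    have hu : a (∏ τ : Gal(K/ℚ), f τ ^ e τ⁻¹) = p • a v := by
      rw [hv, ha_mul, ha_pow]
      have hζ0 : a ζ = 0 := by
        have h1 : (QuotientGroup.mk ζ : (𝓞 K)ˣ ⧸ torsion K) = 1 := (QuotientGroup.eq_one_iff ζ).2 hζ
        simp only [a, h1, ofMul_one]
      rw [hζ0, zero_add]
    have hx' : (1 : ℤ_[p]) ⊗ₜ[ℤ] a (∏ τ : Gal(K/ℚ), f τ ^ e τ⁻¹) = (p : ℤ_[p]) • ((1 : ℤ_[p]) ⊗ₜ[ℤ] a v) := by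
      rw [hu, TensorProduct.tmul_smul, Nat.cast_smul_eq_nsmul]
    apply hbp (Ring.inverse (Fintype.card Gal(K/ℚ) : ℤ_[p]) •
      (((1 : ℤ_[p]) ⊗ₜ[ℤ] a v) - ∑ τ : Gal(K/ℚ), (d τ • b - (e τ⁻¹ : ℤ_[p]) • ρp τ z)))
    rw [smul_comm, smul_sub, ← hx', hx, add_sub_cancel_right, smul_smul, Ring.inverse_mul_cancel _ hG, one_smul]

end Existence

end UnitGalois

end Literature.NumberTheory.NumberFields

end
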